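import Mathlib
import Literature.Combinatorics.ZeroPatterns
import Literature.Computability.AlgebraicComplexity.UniversalCircuit
import HarnessLib

/-!
# Small hitting sets for polynomials of small circuit size exist over every field
# (Heintz–Schnorr 1980, Thm. 4.4 — via the universal circuit and zero-pattern counting)

Topic `Literature/Computability/AlgebraicComplexity`. **Theorem (Heintz–Schnorr 1980, Thm. 4.4,
qualitative form; Forbes–Shpilka–Volk 2018 §1.3 "non-explicit hitting sets"; CKRST 2020 Lemma 12).**
Over ANY field `F`, for all `n, s, d` and every finite `S ⊆ F` with `|S| ≥ 2d + 1`, there is a set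
`H ⊆ Sⁿ` of at most `poly(n, s, d) · log |S|` points such that every NONZERO `f ∈ F[x₁,…,x_n]` of
total degree `≤ d` and circuit size `complexity f ≤ s` is nonzero at some point of `H`
(`HittingSets.exists_hittingSet`; explicit bound
`#H ≤ 9376 (n+d+s+2)²⁶ · (log₂(|S|ⁿ(3d+1)+1) + 1) + 1`).

Heintz–Schnorr prove this (with `H ⊆ [u]ⁿ`, `u = 2s(d+1)²`, `#H = 6(s+1+n)²`, characteristic `0`)
from the Bézout inequality for the variety of easy polynomials. The proof here replaces degree
theory by two inputs already in the tree: (1) the **universal circuit**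
`RazUniversal.exists_universalCircuit` (every such `f` is `U(x, α)` for ONE polynomial `U(x, y)`
with `p = poly(n,d,s)` parameters, `x`-degree `≤ d`, total degree `≤ 3d + 1`), and (2) the
**Rónyai–Babai–Ganapathy zero-pattern bound** `Literature.Combinatorics.RBG.card_patterns_le_pow`:
the polynomials `y ↦ U(a, y)`, `a ∈ Sⁿ`, have at most `(|S|ⁿ(3d+1) + 1)^p` zero-patterns, i.e.
the zero set `Z_y = {a ∈ Sⁿ : U(a, y) = 0}` takes at most that many values as `y` varies; each has
`|Z_y| ≤ d |S|ⁿ⁻¹` when `U(x, y) ≠ 0` (Schwartz–Zippel, Mathlib). Counting `t`-tuples of grid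
points, `#patterns · (d|S|ⁿ⁻¹)^t < |S|^{nt}` as soon as `2^t > #patterns` and `|S| > 2d`, so
some `t`-tuple meets the complement of every `Z_y` — a hitting set.

WHAT THIS IS NOT: no explicit (uniform) construction; the printed quantitative form of [HS80]
(`u = 2s(d+1)²`, `6(s+1+n)²` points) is not reproduced — only "polynomially many points with
coordinates in any prescribed set of `> 2d` field elements".

## References

* [HeintzSchnorr1980] J. Heintz, C.-P. Schnorr, *Testing polynomials which are easy to compute*,
  STOC 1980, Thm. 4.4.
* [RonyaiBabaiGanapathy2001] L. Rónyai, L. Babai, M. K. Ganapathy, J. AMS 14 (2001), Thm. 1.1.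
* [ForbesShpilkaVolk2018] §1.3 (existence of non-explicit succinct hitting sets, citing [HS80]).
* [ChatterjeeKumarRamyaSaptharishiTengse2020] Lemma 12 (the form used for natural proofs).
-/

noncomputable section

open MvPolynomial Finset

namespace Literature.Computability.AlgebraicComplexity

namespace HittingSets

variable {F : Type*} [Field F]

/-! ### Degrees under partial specialisation -/

/-- Weighted degree bound for a substitution: if `deg (φ v) ≤ w v` for every variable then
`deg U(φ) ≤ max_{e ∈ supp U} Σ_v e_v w_v`. [folklore] -/
private theorem totalDegree_aeval_le_of_weights {R : Type*} [CommSemiring R] {σ τ : Type*}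
    [Fintype σ] (U : MvPolynomial σ R) (φ : σ → MvPolynomial τ R) (w : σ → ℕ)
    (hφ : ∀ v, (φ v).totalDegree ≤ w v) {B : ℕ} (hB : ∀ e ∈ U.support, ∑ v, e v * w v ≤ B) :
    (aeval φ U).totalDegree ≤ B := by
  classical
  conv_lhs => rw [U.as_sum]
  rw [map_sum]
  refine totalDegree_finsetSum_le fun e he => ?_
  rw [aeval_monomial]
  refine (totalDegree_mul _ _).trans ?_
  rw [← C_eq_algebraMap, totalDegree_C, zero_add, Finsupp.prod_fintype _ _ (fun _ => pow_zero _)]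
  refine (totalDegree_finsetProd _ _).trans ((Finset.sum_le_sum fun v _ => ?_).trans (hB e he))
  exact (totalDegree_pow _ _).trans (Nat.mul_le_mul_left _ (hφ v))

variable {n p : ℕ}

/-- `U(x, y)` has degree `≤ d` if every monomial of `U` has `x`-degree `≤ d`. [folklore] -/
private theorem totalDegree_specY_le {U : MvPolynomial (Fin n ⊕ Fin p) F} {d : ℕ}
    (hx : ∀ e ∈ U.support, ∑ i : Fin n, e (Sum.inl i) ≤ d) (y : Fin p → F) :
    (aeval (Sum.elim X fun j => C (y j)) U).totalDegree ≤ d := by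
  refine totalDegree_aeval_le_of_weights U _ (Sum.elim (fun _ => 1) (fun _ => 0))
    (fun v => ?_) fun e he => ?_
  · rcases v with i | j
    · simp [totalDegree_X]
    · simp [totalDegree_C]
  · rw [Fintype.sum_sum_type]
    simpa using hx e he

/-- `U(a, y)` has degree at most the total degree of `U`. [folklore] -/
private theorem totalDegree_specX_le (U : MvPolynomial (Fin n ⊕ Fin p) F) (a : Fin n → F) :
    (aeval (Sum.elim (fun i => C (a i)) X) U).totalDegree ≤ U.totalDegree := by
  refine totalDegree_aeval_le_of_weights U _ (fun _ => 1) (fun v => ?_) fun e he => ?_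
  · rcases v with i | j
    · simp [totalDegree_C]
    · simp [totalDegree_X]
  · have h := le_totalDegree he
    rw [Finsupp.sum_fintype _ _ (fun _ => rfl)] at h
    simpa using h

/-- Both specialisations evaluate to `U(a, y)`. [folklore] -/
private theorem eval_specX_eq_eval_specY (U : MvPolynomial (Fin n ⊕ Fin p) F) (a : Fin n → F)
    (y : Fin p → F) :
    eval y (aeval (Sum.elim (fun i => C (a i)) X) U) =
      eval a (aeval (Sum.elim X fun j => C (y j)) U) := by
  rw [aeval_eq_bind₁, aeval_eq_bind₁]
  change eval₂Hom (RingHom.id F) y (bind₁ _ U) = eval₂Hom (RingHom.id F) a (bind₁ _ U)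
  rw [eval₂Hom_bind₁, eval₂Hom_bind₁]
  have hfun : (fun i => eval₂Hom (RingHom.id F) y (Sum.elim (fun i => C (a i)) X i)) =
      (fun i => eval₂Hom (RingHom.id F) a (Sum.elim X (fun j => C (y j)) i)) := by
    funext v
    rcases v with i | j <;> simp
  rw [hfun]

/-! ### Zero sets on the grid -/

/-- Schwartz–Zippel in product form: a nonzero `g` of total degree `≤ d` vanishes on at most a
`d/|S|` fraction of the grid `Sⁿ`: `#zeros · |S| ≤ d · |S|ⁿ`. [folklore] -/
private theorem card_zeros_mul_le [DecidableEq F] {g : MvPolynomial (Fin n) F} (hg : g ≠ 0) {d : ℕ}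
    (hd : g.totalDegree ≤ d) (S : Finset F) :
    ((Fintype.piFinset fun _ : Fin n => S).filter (fun a => eval a g = 0)).card * S.card ≤
      d * S.card ^ n := by
  rcases S.eq_empty_or_nonempty with hS0 | hS
  · rw [hS0, Finset.card_empty, mul_zero]; exact Nat.zero_le _
  have hSpos : (0 : ℚ≥0) < S.card := by exact_mod_cast hS.card_pos
  have h := schwartz_zippel_totalDegree hg S
  rw [div_le_div_iff₀ (by positivity) hSpos] at h
  have h' : (((Fintype.piFinset fun _ : Fin n => S).filter (fun a => eval a g = 0)).card : ℚ≥0) *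
      S.card ≤ d * (S.card : ℚ≥0) ^ n :=
    h.trans (by gcongr)
  exact_mod_cast h'

/-! ### The theorem -/

/-- **Small hitting sets exist over every field (Heintz–Schnorr 1980, Thm. 4.4; qualitative form).**
For every field `F`, all `n, s, d` and every finite `S ⊆ F` with `2d + 1 ≤ |S|`, there is a set `H`
of points with coordinates in `S`, of size
`#H ≤ 9376 (n+d+s+2)²⁶ · (log₂(|S|ⁿ(3d+1)+1) + 1) + 1` (`= poly(n,s,d) · log |S|`), hitting
every nonzero polynomial of total degree `≤ d` and circuit complexity `≤ s`:
`f ≠ 0, deg f ≤ d, L(f) ≤ s ⇒ ∃ a ∈ H, f(a) ≠ 0`. Printed ([HS80] Thm. 4.4, char. `0`): points in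
`[u]ⁿ`, `u = 2s(d+1)²`, `6(s+1+n)²` of them; here: universal circuit + zero-pattern counting
(Rónyai–Babai–Ganapathy) + Schwartz–Zippel, any field.
[cite: HeintzSchnorr1980, Thm. 4.4] -/
theorem exists_hittingSet (n s d : ℕ) (S : Finset F) (hS : 2 * d + 1 ≤ S.card) :
    ∃ H : Finset (Fin n → F), (∀ a ∈ H, ∀ i, a i ∈ S) ∧
      H.card ≤ 9376 * (n + d + s + 2) ^ 26 * (Nat.log 2 (S.card ^ n * (3 * d + 1) + 1) + 1) + 1 ∧
      ∀ f : MvPolynomial (Fin n) F, f.totalDegree ≤ d → complexity f ≤ s → f ≠ 0 →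
        ∃ a ∈ H, eval a f ≠ 0 := by
  classical
  obtain ⟨p, U, hp, -, hx, hdeg, hcov⟩ := RazUniversal.exists_universalCircuit F n s d
  -- the grid and the family of parameter-polynomials indexed by it
  set G : Finset (Fin n → F) := Fintype.piFinset fun _ : Fin n => S with hG
  have hGcard : G.card = S.card ^ n := by
    rw [hG, Fintype.card_piFinset, Finset.prod_const, Finset.card_univ, Fintype.card_fin]
  let g : G → MvPolynomial (Fin p) F := fun a => aeval (Sum.elim (fun i => C (a.1 i)) X) U
  -- the two parameters, kept opaque
  obtain ⟨D, hD⟩ : ∃ D, D = S.card ^ n * (3 * d + 1) := ⟨_, rfl⟩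
  obtain ⟨t, ht⟩ : ∃ t, t = p * (Nat.log 2 (D + 1) + 1) + 1 := ⟨_, rfl⟩
  have ht0 : t ≠ 0 := by rw [ht]; omega
  have hSpos : 0 < S.card := by omega
  have hGne : (fun _ : Fin n => Classical.choice (Finset.card_pos.mp hSpos).to_subtype |>.1) ∈ G := by
    rw [hG, Fintype.mem_piFinset]
    intro i
    exact (Classical.choice (Finset.card_pos.mp hSpos).to_subtype).2
  -- (1) few zero-patterns
  have hpat : (Literature.Combinatorics.RBG.patterns g).card < 2 ^ t := by
    have hsum : ∑ a : G, (g a).totalDegree ≤ D := by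
      calc ∑ a : G, (g a).totalDegree ≤ ∑ _a : G, (3 * d + 1) :=
            Finset.sum_le_sum fun a _ => (totalDegree_specX_le U a.1).trans hdeg
        _ = D := by
            rw [Finset.sum_const, Finset.card_univ, Fintype.card_coe, hGcard, smul_eq_mul, hD]
    refine (Literature.Combinatorics.RBG.card_patterns_le_pow g hsum).trans_lt ?_
    rw [Fintype.card_fin]
    have h1 : D + 1 < 2 ^ (Nat.log 2 (D + 1) + 1) := Nat.lt_pow_succ_log_self (by norm_num) _
    calc (D + 1) ^ p ≤ (2 ^ (Nat.log 2 (D + 1) + 1)) ^ p := Nat.pow_le_pow_left h1.le p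
      _ = 2 ^ (p * (Nat.log 2 (D + 1) + 1)) := by rw [← pow_mul, mul_comm]
      _ < 2 ^ t := Nat.pow_lt_pow_right (by norm_num) (by rw [ht]; omega)
  -- (2) the zero set of a pattern, and its size when it comes from a nonzero specialisation
  let zeros : Finset G → Finset G := fun P => Finset.univ.filter fun a => a ∉ P
  have hzeros_spec : ∀ (y : Fin p → F) (a : G),
      a ∈ zeros (Literature.Combinatorics.RBG.supportPattern g y) ↔
        eval a.1 (aeval (Sum.elim X fun j => C (y j)) U) = 0 := by
    intro y a
    simp only [zeros, Finset.mem_filter, Finset.mem_univ, true_and,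
      Literature.Combinatorics.RBG.mem_supportPattern, not_not, g]
    rw [eval_specX_eq_eval_specY]
  have hzeros_card : ∀ y : Fin p → F, aeval (Sum.elim X fun j => C (y j)) U ≠ 0 →
      (zeros (Literature.Combinatorics.RBG.supportPattern g y)).card * S.card ≤ d * S.card ^ n := by
    intro y hy
    have hle : (zeros (Literature.Combinatorics.RBG.supportPattern g y)).card ≤
        (G.filter (fun a => eval a (aeval (Sum.elim X fun j => C (y j)) U) = 0)).card := by
      refine Finset.card_le_card_of_injOn (fun a : G => a.1) (fun a ha => ?_)
        (fun a _ b _ h => Subtype.ext h)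
      rw [Finset.mem_coe, Finset.mem_filter]
      exact ⟨a.2, (hzeros_spec y a).mp (Finset.mem_coe.mp ha)⟩
    refine (Nat.mul_le_mul_right _ hle).trans ?_
    rw [hG]
    exact card_zeros_mul_le hy (totalDegree_specY_le hx y) S
  -- (3) counting: some `t`-tuple of grid points avoids every small zero set
  let Pats := (Literature.Combinatorics.RBG.patterns g).filter
    fun P => (zeros P).card * S.card ≤ d * S.card ^ n
  let bad : Finset (Fin t → G) := Pats.biUnion fun P => Fintype.piFinset fun _ : Fin t => zeros P
  have hbad : bad.card < (Finset.univ : Finset (Fin t → G)).card := by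
    have h1 : bad.card ≤ ∑ P ∈ Pats, (zeros P).card ^ t := by
      refine Finset.card_biUnion_le.trans (Finset.sum_le_sum fun P _ => ?_)
      rw [Fintype.card_piFinset, Finset.prod_const, Finset.card_univ, Fintype.card_fin]
    have h2 : ∀ P ∈ Pats, (zeros P).card ^ t * S.card ^ t ≤ (d * S.card ^ n) ^ t := by
      intro P hP
      rw [← mul_pow]
      exact Nat.pow_le_pow_left (Finset.mem_filter.mp hP).2 t
    have hΩ : (Finset.univ : Finset (Fin t → G)).card = (S.card ^ n) ^ t := by
      rw [Finset.card_univ, Fintype.card_fun, Fintype.card_fin, Fintype.card_coe, hGcard]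
    have h3 : bad.card * S.card ^ t ≤ Pats.card * (d * S.card ^ n) ^ t := by
      calc bad.card * S.card ^ t ≤ (∑ P ∈ Pats, (zeros P).card ^ t) * S.card ^ t :=
            Nat.mul_le_mul_right _ h1
        _ = ∑ P ∈ Pats, (zeros P).card ^ t * S.card ^ t := Finset.sum_mul _ _ _
        _ ≤ ∑ P ∈ Pats, (d * S.card ^ n) ^ t := Finset.sum_le_sum h2
        _ = Pats.card * (d * S.card ^ n) ^ t := by rw [Finset.sum_const, smul_eq_mul]
    have h4 : Pats.card < 2 ^ t := (Finset.card_filter_le _ _).trans_lt hpat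
    have hlt : Pats.card * d ^ t < S.card ^ t := by
      rcases Nat.eq_zero_or_pos d with hd0 | hdpos
      · rw [hd0, zero_pow ht0, mul_zero]; exact Nat.pow_pos hSpos
      · calc Pats.card * d ^ t < 2 ^ t * d ^ t := Nat.mul_lt_mul_of_pos_right h4 (Nat.pow_pos hdpos)
          _ = (2 * d) ^ t := (mul_pow 2 d t).symm
          _ < S.card ^ t := Nat.pow_lt_pow_left (by omega) ht0
    have h6 : bad.card * S.card ^ t < (Finset.univ : Finset (Fin t → G)).card * S.card ^ t := by
      calc bad.card * S.card ^ t ≤ Pats.card * (d * S.card ^ n) ^ t := h3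
        _ = Pats.card * d ^ t * (S.card ^ n) ^ t := by rw [mul_pow, mul_assoc]
        _ < S.card ^ t * (S.card ^ n) ^ t :=
            Nat.mul_lt_mul_of_pos_right hlt (Nat.pow_pos (by rw [← hGcard]; exact Finset.card_pos.mpr ⟨_, hGne⟩))
        _ = (Finset.univ : Finset (Fin t → G)).card * S.card ^ t := by rw [hΩ, mul_comm]
    exact Nat.lt_of_mul_lt_mul_right h6
  obtain ⟨ω, -, hωbad⟩ : ∃ ω ∈ (Finset.univ : Finset (Fin t → G)), ω ∉ bad := by
    by_contra hcon
    push Not at hcon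
    exact absurd (Finset.card_le_card hcon) (not_le.mpr hbad)
  -- (4) the hitting set
  refine ⟨Finset.univ.image fun k => (ω k).1, ?_, ?_, ?_⟩
  · intro a ha i
    obtain ⟨k, -, rfl⟩ := Finset.mem_image.mp ha
    exact Fintype.mem_piFinset.mp (ω k).2 i
  · calc (Finset.univ.image fun k => (ω k).1).card ≤ (Finset.univ : Finset (Fin t)).card :=
          Finset.card_image_le
      _ = t := by simp
      _ ≤ 9376 * (n + d + s + 2) ^ 26 * (Nat.log 2 (S.card ^ n * (3 * d + 1) + 1) + 1) + 1 := by
          rw [ht, ← hD]; exact Nat.add_le_add_right (Nat.mul_le_mul_right _ hp) 1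
  · intro f hfd hfs hf0
    obtain ⟨α, hα⟩ := hcov f hfd hfs
    have hfy : aeval (Sum.elim X fun j => C (α j)) U = f := hα
    by_contra hall
    push Not at hall
    apply hωbad
    have hP : Literature.Combinatorics.RBG.supportPattern g α ∈ Pats := by
      refine Finset.mem_filter.mpr ⟨Literature.Combinatorics.RBG.supportPattern_mem_patterns g α, ?_⟩
      exact hzeros_card α (by rw [hfy]; exact hf0)
    refine Finset.mem_biUnion.mpr ⟨_, hP, Fintype.mem_piFinset.mpr fun k => ?_⟩
    rw [hzeros_spec α (ω k), hfy]
    exact hall (ω k).1 (Finset.mem_image.mpr ⟨k, Finset.mem_univ _, rfl⟩)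

end HittingSets

end Literature.Computability.AlgebraicComplexity

end
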